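import Summits.BirchSwinnertonDyer.BirchSwinnertonDyer.Theses.PAdicOrderV2
import Literature.NumberTheory.EllipticCurves.PAdicLFunctionRiemannSumCertificateProofs
import Literature.NumberTheory.EllipticCurves.PAdicLFunctionIntegralityProofs

/-!
# Crux `PAdicOrderThesisR2` (stmt-0487) — child C4 of the D6 split: the UNIT-RIEMANN-SUM transfer

Scratch certificate of crux-strategist g1 (wall-breaker), 2026-08-17. NOT a registered line on X
(any `⟨stubs⟩ → X` carries the bare BSD lower bound C5 and dies under prover L5(3); see
`STRATEGY-CENSUS.md` §1). This file types and kernel-checks the FIRST LINE proposed for the child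
item C4 = `PAdicOrderOnePrimeUBHigherRank` (the route's own analytic residue) once the split
`X ⟸ C1 … C5` (glue `KatoSandwich.PAdicOrderThesisR2_of_subs`, p153548) is installed:

* `OnePrimeUBHigherRank` — C4 verbatim (route-file spelling of the D6 children file):
  in analytic rank `r ≥ 2`, some good ordinary `p ≥ 5` with `ord_{T=0} L_p(f, α_p, T) ≤ r` for
  every newform `f` of `E`.
* `UnitRiemannSumHigherRank` — the transferred form C4⁺ ("Λ-form with a finite certificate"):
  some good ordinary NON-ANOMALOUS prime `p > r`, `p ≥ 5`, at which ONE first-layer Riemann sum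
  `RS(k, 1) = ∑_{η} ∑_{s mod p} μ_{f,α}(η γˢ + p²ℤ_p) · (s choose k)` (`padicLRiemannSum f α k 1`,
  a finite sum of the modular symbols `[a/p²]⁺_f`, `[a/p]⁺_f` — the `T^k`-coefficient of the
  first Mazur–Tate element up to the unit `α⁻²`) is a `p`-ADIC UNIT for some `k ≤ r`.
* `onePrimeUBHigherRank_of_unitRiemannSum : UnitRiemannSumHigherRank → OnePrimeUBHigherRank`,
  PROVED (0 sorries) from tree theorems only: at a non-anomalous odd ordinary prime the
  Mazur–Swinnerton-Dyer measure is `ℤ_p`-valued (`norm_msdMeasure_le_one` with the Eisenstein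
  number `n₀ = a_p - p - 1`, prime to `p` iff `a_p ≢ 1`), so the truncation bound of
  `order_padicLFunction_le_of_riemannSum_certificate` (Mazur–Tate–Teitelbaum 1986 §I.11–13;
  Stein–Wuthrich 2013 §3) with `C = 1`, `n = 1`, `‖k!‖_p = 1` (`k ≤ r < p`) reads `p⁻¹ < 1 = ‖RS‖`.

Why C4⁺ is the right first transfer (census §§T9, S⁺9, D8): it is decidable per `(E, p)` by a
finite computation mod `p`; by the Mazur–Tate refined conjecture its residue is the mod-`p`
Mazur–Tate regulator times `#Ш ∏ c_v / #E(ℚ)_tors²` (Mazur–Tate 1987; Bertolini–Darmon 1994);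
on the algebraic side `λ_p = r` for every ordinary `p` outside anomalous ∪ {p ∣ 2#Ш∏c_v} ∪ Π
(Kundu–Ray 2021, arXiv:2102.02411, Thm 3.13; Conjecture: density one) — so C4⁺ is a
Wieferich-type Π₂ statement exactly like the rank-one cell's NW, one rank up; STRONGER than C4
(unit, not merely non-zero), with a horizontal-in-`p` heuristic (defect density ≈ 1/p; census
job j025316). It is OPEN (no tool proves a horizontal non-Wieferich statement for a fixed curve).
-/

set_option linter.dupNamespace false

namespace Summit.BirchSwinnertonDyer.BirchSwinnertonDyer.Cruxes.PAdicOrderThesisR2.UnitRiemannSum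

open Literature.NumberTheory.EllipticCurves Literature.NumberTheory.EllipticCurves.ModularForms

/-- C4 (child `PAdicOrderOnePrimeUBHigherRank` of the D6 split), verbatim. -/
def OnePrimeUBHigherRank : Prop :=
  ∀ (W : WeierstrassCurve ℚ) [W.IsElliptic] [W.IsGloballyMinimal], 2 ≤ W.analyticRank →
    ∃ (p : ℕ) (_ : Fact p.Prime), 5 ≤ p ∧ IsOrdinaryAt W p ∧
      ∀ {N : ℕ} [NeZero N] (f : CuspForm (CongruenceSubgroup.Gamma0 N) 2), IsNewformOf W f →
        (padicLFunction f (unitRoot W p : ℚ_[p])).order ≤ (W.analyticRank : ℕ∞)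

/-- C4⁺ — ONE UNIT FIRST-LAYER RIEMANN SUM at a non-anomalous good ordinary prime `p > r_an`:
for every newform `f` of `E`, some `k ≤ r_an` with `‖RS(k, 1)‖_p = 1`. -/
def UnitRiemannSumHigherRank : Prop :=
  ∀ (W : WeierstrassCurve ℚ) [W.IsElliptic] [W.IsGloballyMinimal], 2 ≤ W.analyticRank →
    ∃ (p : ℕ) (_ : Fact p.Prime), 5 ≤ p ∧ W.analyticRank < p ∧ IsOrdinaryAt W p ∧
      ¬ (p : ℤ) ∣ W.frobeniusTrace p - 1 ∧
      ∀ {N : ℕ} [NeZero N] (f : CuspForm (CongruenceSubgroup.Gamma0 N) 2), IsNewformOf W f →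
        ∃ k ≤ W.analyticRank, ‖padicLRiemannSum f (unitRoot W p : ℚ_[p]) k 1‖ = 1

/-- At a non-anomalous odd good ordinary prime the Mazur–Swinnerton-Dyer measure of the newform of
`E` is `ℤ_p`-valued (Eisenstein number `a_p - p - 1` at `ℓ = p`). -/
theorem norm_msdMeasure_unitRoot_le_one_of_not_anomalous {N : ℕ} [NeZero N]
    {f : CuspForm (CongruenceSubgroup.Gamma0 N) 2} {p : ℕ} [Fact p.Prime]
    {W : WeierstrassCurve ℚ} [W.IsElliptic] [W.IsGloballyMinimal]
    (hp2 : p ≠ 2) (hord : IsOrdinaryAt W p) (hf : IsNewformOf W f)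
    (hna : ¬ (p : ℤ) ∣ W.frobeniusTrace p - 1) (n : ℕ) (a : ZMod (p ^ n)) :
    ‖msdMeasure f (unitRoot W p : ℚ_[p]) n a‖ ≤ 1 := by
  have hp : p.Prime := Fact.out
  have hpN : ¬ p ∣ N := not_dvd_level_of_isNewformOf hf hord.1
  have hap : cuspCoeff f p = ((W.frobeniusTrace p : ℤ) : ℂ) :=
    cuspCoeff_eq_frobeniusTrace_of_isNewformOf_holds hf hord.1
  have h := sub_mul_modularSymbol_zero_mem_periodLattice hf.1 hp hpN
  rw [hap] at h
  have hpn₀ : ¬ (p : ℤ) ∣ W.frobeniusTrace p - (p + 1) := by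
    intro hdvd
    apply hna
    have : W.frobeniusTrace p - 1 = (W.frobeniusTrace p - (p + 1)) + p := by ring
    rw [this]
    exact dvd_add hdvd (dvd_refl _)
  have h0 : ((W.frobeniusTrace p - (p + 1) : ℤ) : ℂ) * modularSymbol f 0 ∈ periodLattice f := by
    push_cast
    convert h using 2
    ring
  exact norm_msdMeasure_le_one hp2 hpN hpn₀ h0 (unitRoot_coe_spec (W := W) hord).2.1 n a

/-- **C4⁺ → C4.** One unit first-layer Riemann sum of index `k ≤ r_an` at a non-anomalous good
ordinary prime `p > r_an` certifies `ord_{T=0} L_p(E,T) ≤ k ≤ r_an` at that prime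
(`order_padicLFunction_le_of_riemannSum_certificate` with `C = 1`, `n = 1`). -/
theorem onePrimeUBHigherRank_of_unitRiemannSum :
    UnitRiemannSumHigherRank → OnePrimeUBHigherRank := by
  intro h W _ _ h2
  obtain ⟨p, hp, h5, hrp, hord, hna, hRS⟩ := h W h2
  refine ⟨p, hp, h5, hord, fun {N} _ f hf => ?_⟩
  obtain ⟨k, hk, hunit⟩ := hRS f hf
  have hprime : p.Prime := Fact.out
  have hp2 : p ≠ 2 := by omega
  have hC : ∀ (n : ℕ) (a : ZMod (p ^ n)), ‖msdMeasure f (unitRoot W p : ℚ_[p]) n a‖ ≤ 1 :=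
    norm_msdMeasure_unitRoot_le_one_of_not_anomalous hp2 hord hf hna
  -- `‖k!‖_p = 1` since `k ≤ r_an < p`
  have hkp : k < p := lt_of_le_of_lt hk hrp
  have hfact : ‖((k.factorial : ℕ) : ℚ_[p])‖ = 1 := by
    refine le_antisymm (by exact_mod_cast Padic.norm_int_le_one (k.factorial : ℤ)) (not_lt.mp fun hlt ↦ ?_)
    have hlt' : ‖((k.factorial : ℤ) : ℚ_[p])‖ < 1 := by exact_mod_cast hlt
    have hdvd : (p : ℤ) ∣ (k.factorial : ℤ) := Padic.norm_intCast_lt_one_iff.mp hlt'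
    have hdvd' : p ∣ k.factorial := by exact_mod_cast hdvd
    exact absurd ((hprime.dvd_factorial).mp hdvd') (not_le.mpr hkp)
  have hlt : (1 : ℝ) / ‖((k.factorial : ℕ) : ℚ_[p])‖ * (p : ℝ) ^ (-1 : ℤ) <
      ‖padicLRiemannSum f (unitRoot W p : ℚ_[p]) k 1‖ := by
    rw [hfact, hunit, div_one, one_mul, zpow_neg_one]
    have hp1 : (1 : ℝ) < p := by exact_mod_cast hprime.one_lt
    exact inv_lt_one_of_one_lt₀ hp1
  have hord_le := order_padicLFunction_le_of_riemannSum_certificate (k := k) (n := 1) hord hf hC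
    (by simpa using hlt)
  exact hord_le.trans (by exact_mod_cast hk)

end Summit.BirchSwinnertonDyer.BirchSwinnertonDyer.Cruxes.PAdicOrderThesisR2.UnitRiemannSum
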